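/-
Copyright: the b2b-balaban T⁴-continuum CRUX team, row NE7b OWNER lineage `t4-ne7b-p1` (gen 137). Project licence.
-/
import Summits.QuantumFields.BalabanUV.T4Continuum.Spine.NE7b.SupBlockTiltedGradientMoments
import Summits.QuantumFields.BalabanUV.T4Continuum.Spine.NE7b.SupBlockNextHessianMatrix

/-!
# THE EXTRACTED PARTS OF A BLOCK INPUT'S LINE FORMAT ARE `−⟨b_D,h⟩` AND `−hᵀK_Dh` — (389)'s BLOCK TWIN.  For a `C³` block potential `U`
# with the block letters, the linear and quadratic Taylor parts `(log Z)′(0)`, `(log Z)″(0)` of the next potential along `ψ₀ + t·h`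
# ((405)∕(406)) ARE
#   `(log Z)′(0) = −⟨b_D(ψ₀), h⟩`   and   `(log Z)″(0) = −hᵀK_D(ψ₀)h`
# with (404)'s vector `b_D(ψ₀)` and symmetric matrix `K_D(ψ₀)` of the BLOCK input, so the Taylor remainder reads
#   `r(h) = log Z(ψ₀+h) − log Z(ψ₀) + ⟨b_D,h⟩ + ½hᵀK_Dh`,   `|r(h)| ≤ ‖h‖³·𝔪∕6`   ((407)'s cubic letter, the moment letters DISCHARGED)
# — the format `Z(ψ₀+h) = Z(ψ₀)·e^{−⟨b_D,h⟩ − ½hᵀK_Dh}·e^{r(h)}` that (385)'s absorption consumes VERBATIM, now for a BLOCK-local input: the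
# first of the four one-line re-runs ((386)∕(389)∕(391)∕(394)) that close the dressed step on the class it produces (row NE7b, node U5c;
# (399)∕(402)–(407) BY NAME; [folklore])

Cell `pub-balaban`, sub-cell `t4`, spine estimate NE7b (`T4WeightBudget.RelWeightBound`; the cell's OWN estimate — NOT PRINTED in
[Bałaban 1983–89], NOT PROVED).  Crux-route work under `Spine/NE7b/` by the row OWNER (`t4-ne7b-p1` gen 137, file (408)) under FREEZE
(0)'s crux-prover clause, on gen 136's SCOPING-d8 DECISION (d8′) («the literal re-run of (386)∕(389)∕(391)∕(394) with `U` for `Σw`»);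
NOTHING of Bałaban's is named as a Lean object, valued or asserted; no `T4Continuum/Support` leaf typed; no `def`, no notation (`b_D`,
`K_D` WRITTEN OUT as in (404)); zero `sorry`.  Imports (BY NAME): the OWNER's (407) `…SupBlockTiltedGradientMoments`
(`block_cubic_taylor_road`), (404) `…SupBlockNextHessianMatrix` (`blockGradient_apply`, `blockHessianMatrix_apply`), and through them
(406) (`blockZ_pos`).

WHAT IS PROVED ([folklore]; `Z(ψ) = ∫e^{−U(ω+ψ)}dN(0,Γ)`):
* §1 **`block_linearPart_eq`** (`(∫e^{−U(ω+ψ₀)}·(−U′(ω+ψ₀)[h]))∕Z(ψ₀) = −⟨b_D(ψ₀),h⟩`), **`block_quadraticPart_eq`** ((406)'s second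
  Taylor coefficient `= −hᵀK_D(ψ₀)h`), `block_remainder_eq` (the Taylor remainder IS `log Z(ψ₀+h) − log Z(ψ₀) + ⟨b_D,h⟩ + ½hᵀK_Dh`);
* §2 THE END **`block_dressed_remainder_cubic`**: under (407)'s hypotheses (`C³` block `U` with the block letters, `Γ(y,y) ≤ γ` on `Y`,
  the upper growth letter, the regulator margins), for EVERY `ψ₀, h`:
  `|log Z(ψ₀+h) − log Z(ψ₀) + ⟨b_D(ψ₀),h⟩ + ½hᵀK_D(ψ₀)h| ≤ ‖h‖³·𝔪∕6` with (407)'s explicit `𝔪 = 𝔪(2Σ_Yψ₀² + 2Σ_Yh²)` — NO moment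
  hypothesis, NO `L_k`; §3 toy.

HONEST (what this is NOT).  Identifications and one rewrite over (404)∕(407); the cubic constant `𝔪` grows like `e^{O(S)}` in the
background size (a small-field letter); no absorption here (that is (385) + the block dressed step), no contraction ((β4)), no decaying-
covariance polymer expansion ((β3′)); scalar skeleton ((A3), NC-NE7b-α UNRULED); nothing of Bałaban's asserted.  BY-NAME EFFECT ON THE
WALL: NONE.  NE7b NOT PRINTED ∕ NOT PROVED; spine PROVED 0∕9; rung (B)+1 — the programme's measures remain FINITE-torus statements; NOT the
mass gap, NOT Clay.  HONEST DEPENDENCY: continuum YM on T⁴ ⇐ BetaPertH ∧ nine spine estimates (0∕9 proved); BetaPertH ⇐ (D1) ∧ (D4) ∧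
CAP+tail; G-an2-4 gates asym, D1 and NE2∕3∕4.
-/

set_option autoImplicit false
set_option maxSynthPendingDepth 2

noncomputable section

namespace Summit.QuantumFields.BalabanUV.T4Continuum.NE7b.SupBlockExtractedPartsIdentified

open MeasureTheory ProbabilityTheory Finset Real Matrix
open scoped BigOperators
open SupBlockNextHessianMatrix (blockGradient_apply blockHessianMatrix_apply)
open SupBlockThirdLetter (blockZ_pos)
open SupBlockTiltedGradientMoments (block_cubic_taylor_road)

variable {ι : Type} [Fintype ι] [DecidableEq ι]

section Road

variable {Γ : Matrix ι ι ℝ} {γop γ : ℝ} {U : EuclideanSpace ℝ ι → ℝ} {U' : EuclideanSpace ℝ ι → EuclideanSpace ℝ ι →L[ℝ] ℝ}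
  {U'' : EuclideanSpace ℝ ι → EuclideanSpace ℝ ι →L[ℝ] EuclideanSpace ℝ ι →L[ℝ] ℝ}
  {U₃ : EuclideanSpace ℝ ι → EuclideanSpace ℝ ι →L[ℝ] EuclideanSpace ℝ ι →L[ℝ] EuclideanSpace ℝ ι →L[ℝ] ℝ} {κ₀ κ₁ κ₂ κ₃ a κu au τ δ θ : ℝ}

/-! ## §1. The linear and quadratic Taylor parts are `−⟨b_D,h⟩` and `−hᵀK_Dh` -/

/-- **THE LINEAR TAYLOR PART OF A BLOCK INPUT IS `−⟨b_D(ψ₀), h⟩`**: under (399)'s hypotheses,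
`(∫e^{−U(ω+ψ₀)}·(−U′(ω+ψ₀)[h]) dN(0,Γ))∕Z(ψ₀) = −⟨b_D(ψ₀), h⟩`. [folklore] -/
theorem block_linearPart_eq (hΓ : Γ.PosSemidef) (hΓop : (γop • (1 : Matrix ι ι ℝ) - Γ).PosSemidef) (Y : Finset ι)
    (hUd : ∀ φ : EuclideanSpace ℝ ι, HasFDerivAt U (U' φ) φ) (hU'c : Continuous U')
    (hκ₀ : 0 ≤ κ₀) (hκ₁ : 0 ≤ κ₁) (ha : 0 ≤ a) (hτ : 0 < τ) (hδ : 0 < δ) (hθ1 : θ < 1)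
    (hκθ : (2 * κ₀ * (1 + τ) + 4 * δ) * γop ≤ θ) (hstab : ∀ φ : EuclideanSpace ℝ ι, -(κ₀ * ∑ x ∈ Y, φ x ^ 2) ≤ U φ)
    (hU'b : ∀ φ : EuclideanSpace ℝ ι, ‖U' φ‖ ≤ κ₁ * (a + ∑ x ∈ Y, φ x ^ 2)) (ψ₀ h : EuclideanSpace ℝ ι) :
    (∫ ω : EuclideanSpace ℝ ι, exp (-U (ω + ψ₀)) * -(U' (ω + ψ₀) h) ∂(multivariateGaussian 0 Γ)) / (∫ ω : EuclideanSpace ℝ ι, exp (-U (ω + ψ₀)) ∂(multivariateGaussian 0 Γ))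
        = -((fun x : ι => ((∫ ω : EuclideanSpace ℝ ι, exp (-U (ω + ψ₀)) ∂(multivariateGaussian 0 Γ))⁻¹ • ∫ ω : EuclideanSpace ℝ ι, exp (-U (ω + ψ₀)) • U' (ω + ψ₀)
        ∂(multivariateGaussian 0 Γ)) (EuclideanSpace.single x (1 : ℝ))) ⬝ᵥ (WithLp.ofLp h)) := by
  rw [blockGradient_apply hΓ hΓop Y hUd hU'c hκ₀ hκ₁ ha hτ hδ hθ1 hκθ hstab hU'b ψ₀ h]
  simp only [mul_neg, integral_neg]
  rw [neg_div, div_eq_inv_mul]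

/-- **THE QUADRATIC TAYLOR PART OF A BLOCK INPUT IS `−hᵀK_D(ψ₀)h`**: under (403)'s hypotheses, (406)'s second Taylor coefficient
`((∫e^{−U}(U′[h]² − U″[h,h]))·Z − (∫e^{−U}(−U′[h]))²)∕Z²` equals `−hᵀK_D(ψ₀)h`. [folklore] -/
theorem block_quadraticPart_eq (hΓ : Γ.PosSemidef) (hΓop : (γop • (1 : Matrix ι ι ℝ) - Γ).PosSemidef) (Y : Finset ι)
    (hUd : ∀ φ : EuclideanSpace ℝ ι, HasFDerivAt U (U' φ) φ) (hU'd : ∀ φ : EuclideanSpace ℝ ι, HasFDerivAt U' (U'' φ) φ)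
    (hU''c : Continuous U'') (hκ₀ : 0 ≤ κ₀) (hκ₁ : 0 ≤ κ₁) (ha : 0 ≤ a) (hκ₂ : 0 ≤ κ₂) (hτ : 0 < τ) (hδ : 0 < δ) (hθ0 : 0 < θ) (hθ1 : θ < 1)
    (hκθ : (2 * κ₀ * (1 + τ) + 4 * δ) * γop ≤ θ) (hstab : ∀ φ : EuclideanSpace ℝ ι, -(κ₀ * ∑ x ∈ Y, φ x ^ 2) ≤ U φ)
    (hU'b : ∀ φ : EuclideanSpace ℝ ι, ‖U' φ‖ ≤ κ₁ * (a + ∑ x ∈ Y, φ x ^ 2)) (hU''b : ∀ φ : EuclideanSpace ℝ ι, ‖U'' φ‖ ≤ κ₂)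
    (ψ₀ h : EuclideanSpace ℝ ι) :
    ((∫ ω : EuclideanSpace ℝ ι, exp (-U (ω + ψ₀)) * (U' (ω + ψ₀) h * U' (ω + ψ₀) h - U'' (ω + ψ₀) h h) ∂(multivariateGaussian 0 Γ)) * (∫ ω : EuclideanSpace ℝ ι, exp (-U (ω
        + ψ₀)) ∂(multivariateGaussian 0 Γ)) - (∫ ω : EuclideanSpace ℝ ι, exp (-U (ω + ψ₀)) * -(U' (ω + ψ₀) h) ∂(multivariateGaussian 0 Γ)) * (∫ ω : EuclideanSpace ℝ ι, exp
        (-U (ω + ψ₀)) * -(U' (ω + ψ₀) h) ∂(multivariateGaussian 0 Γ))) / (∫ ω : EuclideanSpace ℝ ι, exp (-U (ω + ψ₀)) ∂(multivariateGaussian 0 Γ)) ^ 2 = -((WithLp.ofLp h)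
        ⬝ᵥ (Matrix.of fun x y : ι => (((∫ ω : EuclideanSpace ℝ ι, exp (-U (ω + ψ₀)) ∂(multivariateGaussian 0 Γ))⁻¹ • (∫ ω : EuclideanSpace ℝ ι, exp (-U (ω + ψ₀)) • (U'' (ω
        + ψ₀) - (U' (ω + ψ₀)).smulRight (U' (ω + ψ₀))) ∂(multivariateGaussian 0 Γ)) + (((∫ ω : EuclideanSpace ℝ ι, exp (-U (ω + ψ₀)) ∂(multivariateGaussian 0 Γ)) ^ 2)⁻¹ • ∫
        ω : EuclideanSpace ℝ ι, exp (-U (ω + ψ₀)) • U' (ω + ψ₀) ∂(multivariateGaussian 0 Γ)).smulRight (∫ ω : EuclideanSpace ℝ ι, exp (-U (ω + ψ₀)) • U' (ω + ψ₀)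
        ∂(multivariateGaussian 0 Γ))) (EuclideanSpace.single x (1 : ℝ)) (EuclideanSpace.single y (1 : ℝ)) + ((∫ ω : EuclideanSpace ℝ ι, exp (-U (ω + ψ₀))
        ∂(multivariateGaussian 0 Γ))⁻¹ • (∫ ω : EuclideanSpace ℝ ι, exp (-U (ω + ψ₀)) • (U'' (ω + ψ₀) - (U' (ω + ψ₀)).smulRight (U' (ω + ψ₀))) ∂(multivariateGaussian 0 Γ))
        + (((∫ ω : EuclideanSpace ℝ ι, exp (-U (ω + ψ₀)) ∂(multivariateGaussian 0 Γ)) ^ 2)⁻¹ • ∫ ω : EuclideanSpace ℝ ι, exp (-U (ω + ψ₀)) • U' (ω + ψ₀)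
        ∂(multivariateGaussian 0 Γ)).smulRight (∫ ω : EuclideanSpace ℝ ι, exp (-U (ω + ψ₀)) • U' (ω + ψ₀) ∂(multivariateGaussian 0 Γ))) (EuclideanSpace.single y (1 : ℝ))
        (EuclideanSpace.single x (1 : ℝ))) / 2) *ᵥ (WithLp.ofLp h)) := by
  rw [blockHessianMatrix_apply hΓ hΓop Y hUd hU'd hU''c hκ₀ hκ₁ ha hκ₂ hτ hδ hθ1 hκθ hstab hU'b hU''b ψ₀ h]
  have hZ := (blockZ_pos hΓ hΓop Y hUd hκ₀ hτ hδ hθ0 hθ1 hκθ hstab ψ₀ h 0).2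
  simp only [zero_smul, add_zero] at hZ
  -- the two sign flips under the integral
  have i1 : (∫ ω : EuclideanSpace ℝ ι, exp (-U (ω + ψ₀)) * (U' (ω + ψ₀) h * U' (ω + ψ₀) h - U'' (ω + ψ₀) h h) ∂(multivariateGaussian 0 Γ)) = -(∫ ω : EuclideanSpace ℝ ι, exp
      (-U (ω + ψ₀)) * (U'' (ω + ψ₀) h h - U' (ω + ψ₀) h * U' (ω + ψ₀) h) ∂(multivariateGaussian 0 Γ)) := by
    rw [← integral_neg]
    refine integral_congr_ae (ae_of_all _ fun ω => ?_)
    dsimp only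
    ring
  have i2 : (∫ ω : EuclideanSpace ℝ ι, exp (-U (ω + ψ₀)) * -(U' (ω + ψ₀) h) ∂(multivariateGaussian 0 Γ)) = -(∫ ω : EuclideanSpace ℝ ι, exp (-U (ω + ψ₀)) * U' (ω + ψ₀) h
      ∂(multivariateGaussian 0 Γ)) := by
    rw [← integral_neg]
    refine integral_congr_ae (ae_of_all _ fun ω => ?_)
    dsimp only
    ring
  rw [i1, i2]
  field_simp
  ring

/-- **THE TAYLOR REMAINDER IN ABSORPTION TERMS**: (406)'s remainder `log Z(ψ₀+h) − log Z(ψ₀) − (log Z)′(0) − ½(log Z)″(0)` IS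
`log Z(ψ₀+h) − log Z(ψ₀) + ⟨b_D(ψ₀),h⟩ + ½hᵀK_D(ψ₀)h`. [folklore] -/
theorem block_remainder_eq (hΓ : Γ.PosSemidef) (hΓop : (γop • (1 : Matrix ι ι ℝ) - Γ).PosSemidef) (Y : Finset ι)
    (hUd : ∀ φ : EuclideanSpace ℝ ι, HasFDerivAt U (U' φ) φ) (hU'd : ∀ φ : EuclideanSpace ℝ ι, HasFDerivAt U' (U'' φ) φ)
    (hU''c : Continuous U'') (hκ₀ : 0 ≤ κ₀) (hκ₁ : 0 ≤ κ₁) (ha : 0 ≤ a) (hκ₂ : 0 ≤ κ₂) (hτ : 0 < τ) (hδ : 0 < δ) (hθ0 : 0 < θ) (hθ1 : θ < 1)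
    (hκθ : (2 * κ₀ * (1 + τ) + 4 * δ) * γop ≤ θ) (hstab : ∀ φ : EuclideanSpace ℝ ι, -(κ₀ * ∑ x ∈ Y, φ x ^ 2) ≤ U φ)
    (hU'b : ∀ φ : EuclideanSpace ℝ ι, ‖U' φ‖ ≤ κ₁ * (a + ∑ x ∈ Y, φ x ^ 2)) (hU''b : ∀ φ : EuclideanSpace ℝ ι, ‖U'' φ‖ ≤ κ₂)
    (ψ₀ h : EuclideanSpace ℝ ι) :
    Real.log (∫ ω : EuclideanSpace ℝ ι, exp (-U (ω + (ψ₀ + h))) ∂(multivariateGaussian 0 Γ)) - Real.log (∫ ω : EuclideanSpace ℝ ι, exp (-U (ω + ψ₀)) ∂(multivariateGaussian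
        0 Γ)) - (∫ ω : EuclideanSpace ℝ ι, exp (-U (ω + ψ₀)) * -(U' (ω + ψ₀) h) ∂(multivariateGaussian 0 Γ)) / (∫ ω : EuclideanSpace ℝ ι, exp (-U (ω + ψ₀))
        ∂(multivariateGaussian 0 Γ)) - ((∫ ω : EuclideanSpace ℝ ι, exp (-U (ω + ψ₀)) * (U' (ω + ψ₀) h * U' (ω + ψ₀) h - U'' (ω + ψ₀) h h) ∂(multivariateGaussian 0 Γ)) * (∫
        ω : EuclideanSpace ℝ ι, exp (-U (ω + ψ₀)) ∂(multivariateGaussian 0 Γ)) - (∫ ω : EuclideanSpace ℝ ι, exp (-U (ω + ψ₀)) * -(U' (ω + ψ₀) h) ∂(multivariateGaussian 0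
        Γ)) * (∫ ω : EuclideanSpace ℝ ι, exp (-U (ω + ψ₀)) * -(U' (ω + ψ₀) h) ∂(multivariateGaussian 0 Γ))) / (∫ ω : EuclideanSpace ℝ ι, exp (-U (ω + ψ₀))
        ∂(multivariateGaussian 0 Γ)) ^ 2 / 2 =
      Real.log (∫ ω : EuclideanSpace ℝ ι, exp (-U (ω + (ψ₀ + h))) ∂(multivariateGaussian 0 Γ)) - Real.log (∫ ω : EuclideanSpace ℝ ι, exp (-U (ω + ψ₀))
          ∂(multivariateGaussian 0 Γ)) + ((fun x : ι => ((∫ ω : EuclideanSpace ℝ ι, exp (-U (ω + ψ₀)) ∂(multivariateGaussian 0 Γ))⁻¹ • ∫ ω : EuclideanSpace ℝ ι, exp (-U (ω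
          + ψ₀)) • U' (ω + ψ₀) ∂(multivariateGaussian 0 Γ)) (EuclideanSpace.single x (1 : ℝ))) ⬝ᵥ (WithLp.ofLp h)) + ((WithLp.ofLp h) ⬝ᵥ (Matrix.of fun x y : ι => (((∫ ω :
          EuclideanSpace ℝ ι, exp (-U (ω + ψ₀)) ∂(multivariateGaussian 0 Γ))⁻¹ • (∫ ω : EuclideanSpace ℝ ι, exp (-U (ω + ψ₀)) • (U'' (ω + ψ₀) - (U' (ω + ψ₀)).smulRight (U'
          (ω + ψ₀))) ∂(multivariateGaussian 0 Γ)) + (((∫ ω : EuclideanSpace ℝ ι, exp (-U (ω + ψ₀)) ∂(multivariateGaussian 0 Γ)) ^ 2)⁻¹ • ∫ ω : EuclideanSpace ℝ ι, exp (-U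
          (ω + ψ₀)) • U' (ω + ψ₀) ∂(multivariateGaussian 0 Γ)).smulRight (∫ ω : EuclideanSpace ℝ ι, exp (-U (ω + ψ₀)) • U' (ω + ψ₀) ∂(multivariateGaussian 0 Γ)))
          (EuclideanSpace.single x (1 : ℝ)) (EuclideanSpace.single y (1 : ℝ)) + ((∫ ω : EuclideanSpace ℝ ι, exp (-U (ω + ψ₀)) ∂(multivariateGaussian 0 Γ))⁻¹ • (∫ ω :
          EuclideanSpace ℝ ι, exp (-U (ω + ψ₀)) • (U'' (ω + ψ₀) - (U' (ω + ψ₀)).smulRight (U' (ω + ψ₀))) ∂(multivariateGaussian 0 Γ)) + (((∫ ω : EuclideanSpace ℝ ι, exp (-U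
          (ω + ψ₀)) ∂(multivariateGaussian 0 Γ)) ^ 2)⁻¹ • ∫ ω : EuclideanSpace ℝ ι, exp (-U (ω + ψ₀)) • U' (ω + ψ₀) ∂(multivariateGaussian 0 Γ)).smulRight (∫ ω :
          EuclideanSpace ℝ ι, exp (-U (ω + ψ₀)) • U' (ω + ψ₀) ∂(multivariateGaussian 0 Γ))) (EuclideanSpace.single y (1 : ℝ)) (EuclideanSpace.single x (1 : ℝ))) / 2) *ᵥ
          (WithLp.ofLp h)) / 2 := by
  have hU'c : Continuous U' := continuous_iff_continuousAt.2 fun φ => (hU'd φ).continuousAt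
  rw [block_linearPart_eq hΓ hΓop Y hUd hU'c hκ₀ hκ₁ ha hτ hδ hθ1 hκθ hstab hU'b ψ₀ h, block_quadraticPart_eq hΓ hΓop Y hUd hU'd hU''c hκ₀ hκ₁ ha hκ₂ hτ hδ hθ0 hθ1 hκθ
      hstab hU'b hU''b ψ₀ h]
  ring

/-! ## §2. THE END: the cubic letter of the block remainder in absorption terms -/

/-- **THE CUBIC LETTER OF THE DRESSED REMAINDER OF A BLOCK INPUT — NO MOMENT HYPOTHESIS.**  Under (407)'s hypotheses (`Γ ⪰ 0`,
`Γ ⪯ γ_op·1`, `Γ(y,y) ≤ γ` on `Y`; `C³` block `U` with stability `κ₀`, gradient letter `κ₁, a`, `‖U″‖ ≤ κ₂`, `‖U‴‖ ≤ κ₃`, upper growth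
`κ_u, a_u`; `0 < τ, δ`, `0 < θ < 1`, `(2κ₀(1+τ)+4δ)γ_op ≤ θ`), for EVERY `ψ₀, h`:
`|log Z(ψ₀+h) − log Z(ψ₀) + ⟨b_D(ψ₀),h⟩ + ½hᵀK_D(ψ₀)h| ≤ ‖h‖³·𝔪∕6`, `𝔪 = (m₃ + 3κ₂m₁ + κ₃) + 3m₁(m₂ + κ₂) + 2m₁³` at
`m_k = m_k(2Σ_Yψ₀² + 2Σ_Yh²)` ((407)'s explicit moment constants). [folklore] -/
theorem block_dressed_remainder_cubic (hΓ : Γ.PosSemidef) (hΓop : (γop • (1 : Matrix ι ι ℝ) - Γ).PosSemidef) (Y : Finset ι)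
    (hdiag : ∀ i ∈ Y, Γ i i ≤ γ)
    (hUd : ∀ φ : EuclideanSpace ℝ ι, HasFDerivAt U (U' φ) φ) (hU'd : ∀ φ : EuclideanSpace ℝ ι, HasFDerivAt U' (U'' φ) φ)
    (hU''d : ∀ φ : EuclideanSpace ℝ ι, HasFDerivAt U'' (U₃ φ) φ) (hU₃c : Continuous U₃)
    (hκ₀ : 0 ≤ κ₀) (hκ₁ : 0 ≤ κ₁) (ha : 0 ≤ a) (hκ₂ : 0 ≤ κ₂) (hκ₃ : 0 ≤ κ₃) (hκu : 0 ≤ κu) (hau : 0 ≤ au) (hτ : 0 < τ) (hδ : 0 < δ)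
    (hθ0 : 0 < θ) (hθ1 : θ < 1) (hκθ : (2 * κ₀ * (1 + τ) + 4 * δ) * γop ≤ θ)
    (hstab : ∀ φ : EuclideanSpace ℝ ι, -(κ₀ * ∑ x ∈ Y, φ x ^ 2) ≤ U φ)
    (hU'b : ∀ φ : EuclideanSpace ℝ ι, ‖U' φ‖ ≤ κ₁ * (a + ∑ x ∈ Y, φ x ^ 2)) (hU''b : ∀ φ : EuclideanSpace ℝ ι, ‖U'' φ‖ ≤ κ₂)
    (hU₃b : ∀ φ : EuclideanSpace ℝ ι, ‖U₃ φ‖ ≤ κ₃) (hUup : ∀ φ : EuclideanSpace ℝ ι, U φ ≤ κu * (au + ∑ x ∈ Y, φ x ^ 2))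
    (ψ₀ h : EuclideanSpace ℝ ι) :
    |Real.log (∫ ω : EuclideanSpace ℝ ι, exp (-U (ω + (ψ₀ + h))) ∂(multivariateGaussian 0 Γ)) - Real.log (∫ ω : EuclideanSpace ℝ ι, exp (-U (ω + ψ₀)) ∂(multivariateGaussian
        0 Γ)) + ((fun x : ι => ((∫ ω : EuclideanSpace ℝ ι, exp (-U (ω + ψ₀)) ∂(multivariateGaussian 0 Γ))⁻¹ • ∫ ω : EuclideanSpace ℝ ι, exp (-U (ω + ψ₀)) • U' (ω + ψ₀)
        ∂(multivariateGaussian 0 Γ)) (EuclideanSpace.single x (1 : ℝ))) ⬝ᵥ (WithLp.ofLp h)) + ((WithLp.ofLp h) ⬝ᵥ (Matrix.of fun x y : ι => (((∫ ω : EuclideanSpace ℝ ι, exp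
        (-U (ω + ψ₀)) ∂(multivariateGaussian 0 Γ))⁻¹ • (∫ ω : EuclideanSpace ℝ ι, exp (-U (ω + ψ₀)) • (U'' (ω + ψ₀) - (U' (ω + ψ₀)).smulRight (U' (ω + ψ₀)))
        ∂(multivariateGaussian 0 Γ)) + (((∫ ω : EuclideanSpace ℝ ι, exp (-U (ω + ψ₀)) ∂(multivariateGaussian 0 Γ)) ^ 2)⁻¹ • ∫ ω : EuclideanSpace ℝ ι, exp (-U (ω + ψ₀)) • U'
        (ω + ψ₀) ∂(multivariateGaussian 0 Γ)).smulRight (∫ ω : EuclideanSpace ℝ ι, exp (-U (ω + ψ₀)) • U' (ω + ψ₀) ∂(multivariateGaussian 0 Γ))) (EuclideanSpace.single x (1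
        : ℝ)) (EuclideanSpace.single y (1 : ℝ)) + ((∫ ω : EuclideanSpace ℝ ι, exp (-U (ω + ψ₀)) ∂(multivariateGaussian 0 Γ))⁻¹ • (∫ ω : EuclideanSpace ℝ ι, exp (-U (ω +
        ψ₀)) • (U'' (ω + ψ₀) - (U' (ω + ψ₀)).smulRight (U' (ω + ψ₀))) ∂(multivariateGaussian 0 Γ)) + (((∫ ω : EuclideanSpace ℝ ι, exp (-U (ω + ψ₀)) ∂(multivariateGaussian 0
        Γ)) ^ 2)⁻¹ • ∫ ω : EuclideanSpace ℝ ι, exp (-U (ω + ψ₀)) • U' (ω + ψ₀) ∂(multivariateGaussian 0 Γ)).smulRight (∫ ω : EuclideanSpace ℝ ι, exp (-U (ω + ψ₀)) • U' (ω +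
        ψ₀) ∂(multivariateGaussian 0 Γ))) (EuclideanSpace.single y (1 : ℝ)) (EuclideanSpace.single x (1 : ℝ))) / 2) *ᵥ (WithLp.ofLp h)) / 2| ≤
      ‖h‖ ^ 3 * ((((κ₁ ^ 3 * (4 * (a + 2 * (2 * ∑ x ∈ Y, ψ₀ x ^ 2 + 2 * ∑ x ∈ Y, h x ^ 2)) ^ 3 + 32 * (δ ^ 3)⁻¹) * exp (κ₀ * (1 + τ⁻¹) * (2 * ∑ x ∈ Y, ψ₀ x ^ 2 + 2 * ∑ x ∈
          Y, h x ^ 2))) * ((1 - θ) ^ (-((2 * κ₀ * (1 + τ) + 4 * δ) * γ / (2 * θ)))) ^ Y.card * exp (κu * (au + ∑ x ∈ Y, Γ x x + (2 * ∑ x ∈ Y, ψ₀ x ^ 2 + 2 * ∑ x ∈ Y, h x ^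
          2)))) + 3 * κ₂ * ((κ₁ * ((a + 2 * (2 * ∑ x ∈ Y, ψ₀ x ^ 2 + 2 * ∑ x ∈ Y, h x ^ 2)) + δ⁻¹) * exp (κ₀ * (1 + τ⁻¹) * (2 * ∑ x ∈ Y, ψ₀ x ^ 2 + 2 * ∑ x ∈ Y, h x ^ 2)))
          * ((1 - θ) ^ (-((2 * κ₀ * (1 + τ) + 4 * δ) * γ / (2 * θ)))) ^ Y.card * exp (κu * (au + ∑ x ∈ Y, Γ x x + (2 * ∑ x ∈ Y, ψ₀ x ^ 2 + 2 * ∑ x ∈ Y, h x ^ 2)))) + κ₃) +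
          3 * ((κ₁ * ((a + 2 * (2 * ∑ x ∈ Y, ψ₀ x ^ 2 + 2 * ∑ x ∈ Y, h x ^ 2)) + δ⁻¹) * exp (κ₀ * (1 + τ⁻¹) * (2 * ∑ x ∈ Y, ψ₀ x ^ 2 + 2 * ∑ x ∈ Y, h x ^ 2))) * ((1 - θ) ^
          (-((2 * κ₀ * (1 + τ) + 4 * δ) * γ / (2 * θ)))) ^ Y.card * exp (κu * (au + ∑ x ∈ Y, Γ x x + (2 * ∑ x ∈ Y, ψ₀ x ^ 2 + 2 * ∑ x ∈ Y, h x ^ 2)))) * (((κ₁ ^ 2 * (2 * (a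
          + 2 * (2 * ∑ x ∈ Y, ψ₀ x ^ 2 + 2 * ∑ x ∈ Y, h x ^ 2)) ^ 2 + 8 * (δ ^ 2)⁻¹) * exp (κ₀ * (1 + τ⁻¹) * (2 * ∑ x ∈ Y, ψ₀ x ^ 2 + 2 * ∑ x ∈ Y, h x ^ 2))) * ((1 - θ) ^
          (-((2 * κ₀ * (1 + τ) + 4 * δ) * γ / (2 * θ)))) ^ Y.card * exp (κu * (au + ∑ x ∈ Y, Γ x x + (2 * ∑ x ∈ Y, ψ₀ x ^ 2 + 2 * ∑ x ∈ Y, h x ^ 2)))) + κ₂) + 2 * ((κ₁ *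
          ((a + 2 * (2 * ∑ x ∈ Y, ψ₀ x ^ 2 + 2 * ∑ x ∈ Y, h x ^ 2)) + δ⁻¹) * exp (κ₀ * (1 + τ⁻¹) * (2 * ∑ x ∈ Y, ψ₀ x ^ 2 + 2 * ∑ x ∈ Y, h x ^ 2))) * ((1 - θ) ^ (-((2 * κ₀
          * (1 + τ) + 4 * δ) * γ / (2 * θ)))) ^ Y.card * exp (κu * (au + ∑ x ∈ Y, Γ x x + (2 * ∑ x ∈ Y, ψ₀ x ^ 2 + 2 * ∑ x ∈ Y, h x ^ 2)))) ^ 3) / 6 := by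
  have hU''c : Continuous U'' := continuous_iff_continuousAt.2 fun φ => (hU''d φ).continuousAt
  have h3 := (block_cubic_taylor_road hΓ hΓop Y hdiag hUd hU'd hU''d hU₃c hκ₀ hκ₁ ha hκ₂ hκ₃ hκu hau hτ hδ hθ0 hθ1 hκθ hstab hU'b hU''b hU₃b hUup ψ₀ h).1
  simp only [zero_smul, add_zero, one_smul] at h3
  rw [block_remainder_eq hΓ hΓop Y hUd hU'd hU''c hκ₀ hκ₁ ha hκ₂ hτ hδ hθ0 hθ1 hκθ hstab hU'b hU''b ψ₀ h] at h3
  exact h3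

end Road

/-! ## §3. Toy -/

/-- Toy (§1's algebra): `a − (−b) − (−c)∕2 = a + b + c∕2`. -/
example (a b c : ℝ) : a - -b - -c / 2 = a + b + c / 2 := by ring

end Summit.QuantumFields.BalabanUV.T4Continuum.NE7b.SupBlockExtractedPartsIdentified
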